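import Summits.QuantumFields.YangMills.Theorems.LangevinControlUVFemtoCurvatureTwoPointCDefsCore
import Summits.QuantumFields.YangMills.Theorems.LangevinControlUVFemtoCurvatureTwoPointCBirthVarianceEvenBulkStub
import Summits.QuantumFields.YangMills.Theorems.LangevinControlUVFemtoCurvatureTwoPointCBirthVarianceEvenMidStub
import HarnessLib

/-!
# Route `LangevinControlUV`, crux `FemtoCurvatureTwoPointC` (stmt-QuantumFields-16204): line `conditional-covariance-floor`,
# the upper-channels bridge for stub Up (`stub_upperChannels`)

The skeleton `Cruxes/FemtoCurvatureTwoPointC/Lines/conditional_covariance_floor.lean` bundles the three UPPER matching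
clauses of the femto-engine statement `AFProfilesCoreAt r` (`…CDefsCore`) into ONE stub Up = `stub_upperChannels`: for
every compact simple `G`, faithful unitary `r` and EVERY box coupling `u` carrying the R-bundle (admissibility, continuity,
freezing, bare size, in-window comparability, dyadic AF step law, DIAGONAL two-sided matching on window boxes), beyond ONE
threshold `β₁` and with ONE constant `C'`, on window boxes (every sub-box `8 ≤ M ≤ L` has `u M β ≤ u₀`):

* TU — transverse upper profile `s⁸·Cov_{L,β}(P_0^{01}, P_{se₂}^{01}) ≤ C'·u(8s,β)²` (`8 ≤ L`, `1 ≤ s`, `8s ≤ L`);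
* LU — longitudinal upper profile `s⁸·|Cov_{L,β}(P_0^{01}, P_{se₀}^{01})| ≤ C'·u(8s,β)²` (same range);
* V — variance ceiling `Var_{L,β}(P_0^{01}) ≤ C'·u(8,β)²` (`8 ≤ L`).

The sibling line `birth` (`Cruxes/FemtoCurvatureTwoPointC/Lines/birth.lean`) carries the SAME three clauses as separate
stubs: TU is the second conjunct of its `stub_volumeDecoupling`, LU is its `stub_longitudinalUpper`, and V is cut into four
pieces by the parity of `L` and the size of `log β` — V_even-bulk (`Even L`, `log β ≤ L`; CLOSED, the landed
`stub_varianceCeilingEvenBulk`, p150733), V_even-mid (`Even L`, `L < log β ≤ L⁴`; CLOSED, the landed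
`stub_varianceCeilingEvenMid`, p155166), V_even-deep (`Even L`, `L⁴ < log β`; open) and V_odd (`Odd L`; open).

This file proves, sorry-free, the purely logical BRIDGES that make the two lines share every future landing. For a GIVEN
coupling `u`:

* `varianceCeiling_of_evenDeep_odd` (registered sub-goal) — the R-bundle `hR` (verbatim the antecedent of the registered
  `stub_upperChannels`) together with V_even-deep (`hVD`) and V_odd (`hVO`), each verbatim the consequent of the
  corresponding birth stub for this `u`, imply the full variance ceiling V (verbatim Up's third conjunct). The two CLOSED
  pieces are USED, not assumed: the landed `stub_varianceCeilingEvenBulk` / `stub_varianceCeilingEvenMid` are applied to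
  `hR` inside the proof. Case split on `Nat.even_or_odd L`, then `log β ≤ L`, then `log β ≤ L⁴`.
* `upperChannels_of_channels` (registered sub-goal) — TU (`hTU`, the conclusion-shape of Up's first conjunct = the second
  conjunct of birth's D), LU (`hLU`, verbatim the consequent of `stub_longitudinalUpper`) and V (`hV`) imply Up's
  conclusion (verbatim): ONE threshold and ONE constant for the three clauses.
* `upperChannels_of_parts` — the composition: `hR`, `hTU`, `hLU`, `hVD`, `hVO` imply Up's conclusion. (Its one-line
  signature exceeds the registry's 4000-character bound, which is why the two halves are the registered sub-goals.)

Proofs. Thresholds and constants are merged by `max`; every clause has the monotone shape `x ≤ K·t²` (`le_max_mul_sq`,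
`le_max_mul_sq'`, copied from birth.lean where they are private). The only textual difference between LU's registered
consequent in birth (`s⁸·|E(…) - E(…)·E(…)|`) and Up's second conjunct (`s⁸·|(E(…) - E(…)·E(…))|`) is a pair of grouping
parentheses; the two elaborate to the same term.

Design. All hypothesis texts are kept CHARACTER FOR CHARACTER equal to the registered stub texts, and the conclusions are
character for character the consequent of `stub_upperChannels` (resp. its third conjunct); the lead instantiates
`upperChannels_of_parts G hG r u u₀ β₀ κ₁ κ₂ κ₃ c C c₈ hR hTU hLU hVD hVO` in the composition `afProfilesCoreAt_of_floor`.
Nothing in this file is physics and nothing is asserted unconditionally. Deliberately NOT here: TU, LU, V_even-deep, V_odd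
themselves (weak-coupling cluster-expansion / holonomy-sector statements, open), R, and the lower clauses of the line.
-/

set_option autoImplicit false

noncomputable section

open Filter Topology MeasureTheory
open Literature.MathematicalPhysics.QuantumFieldTheory

namespace Summit.QuantumFields.YangMills.Theorems.FemtoCurvatureTwoPointC

/-- Monotonicity helper: enlarge the constant in `x ≤ C * t ^ 2` to `max C C'`. [folklore] -/
-- adapted from the private `le_max_mul_sq` of `Cruxes/FemtoCurvatureTwoPointC/Lines/birth.lean`
private theorem le_max_mul_sq {x C C' t : ℝ} (h : x ≤ C * t ^ 2) : x ≤ max C C' * t ^ 2 :=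
  h.trans (mul_le_mul_of_nonneg_right (le_max_left _ _) (sq_nonneg _))

/-- Monotonicity helper: enlarge the constant in `x ≤ C' * t ^ 2` to `max C C'`. [folklore] -/
-- adapted from the private `le_max_mul_sq'` of `Cruxes/FemtoCurvatureTwoPointC/Lines/birth.lean`
private theorem le_max_mul_sq' {x C C' t : ℝ} (h : x ≤ C' * t ^ 2) : x ≤ max C C' * t ^ 2 :=
  h.trans (mul_le_mul_of_nonneg_right (le_max_right _ _) (sq_nonneg _))

/-- **V ⟸ R-bundle ∧ V_even-deep ∧ V_odd, the even boxes with `log β ≤ L⁴` being LANDED (line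
`conditional-covariance-floor`, sorry-free bridge; registered sub-goal `varianceCeiling_of_evenDeep_odd`).**
For a compact simple Lie group `G`, a lattice representation `r`, and a GIVEN box coupling `u : ℕ → ℝ → ℝ` with constants
`u₀ β₀ κ₁ κ₂ κ₃ c C c₈` carrying the R-bundle `hR` (admissibility, continuity, freezing, bare size `c₈ ≤ β·u(8,β)`,
in-window comparability, dyadic AF step law, DIAGONAL matching on window boxes `L ≥ 8`; verbatim the antecedent of the
registered `stub_upperChannels`): if the plaquette variance satisfies `Var_{L,β}(P_0^{01}) ≤ C'·u(8,β)²` beyond a threshold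
on EVEN window boxes `L ≥ 8` in the deep-femto corner `L⁴ < log β` (`hVD`, verbatim the consequent of birth's
`stub_varianceCeilingEvenDeep`) and on ODD window boxes `L ≥ 8` (`hVO`, verbatim the consequent of birth's
`stub_varianceCeilingOdd`), then it does so on ALL window boxes `L ≥ 8` (verbatim the third conjunct of Up). The even boxes
with `log β ≤ L` and `L < log β ≤ L⁴` are covered by the landed `stub_varianceCeilingEvenBulk` (p150733) and
`stub_varianceCeilingEvenMid` (p155166) applied to `hR`. Witnesses: `max (max β_bulk β_mid) (max β_deep β_odd)` and the same
`max`-tree of constants. `P` is the plaquette field `x i j U ↦ N - Re tr ρ(U_{x,ij})`, `E` the Wilson expectation at `β`.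
[folklore] -/
theorem varianceCeiling_of_evenDeep_odd :
    ∀ (G : Type) [Group G] [TopologicalSpace G] [IsTopologicalGroup G] [CompactSpace G]
        [MeasurableSpace G] [BorelSpace G], IsCompactSimpleLieGroup G →
        ∀ r : LatticeRep G, ∀ (u : ℕ → ℝ → ℝ) (u₀ β₀ κ₁ κ₂ κ₃ c C c₈ : ℝ),
      (0 < u₀ ∧ 0 < c ∧ 0 < κ₁ ∧ 0 ≤ κ₃ ∧ 0 < c₈ ∧
        (∀ (L : ℕ) (β : ℝ), 8 ≤ L → β₀ ≤ β → 0 < u L β) ∧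
        (∀ L : ℕ, 8 ≤ L → ContinuousOn (u L) (Set.Ici β₀)) ∧
        (∀ L : ℕ, 8 ≤ L → Filter.Tendsto (u L) Filter.atTop (nhds 0)) ∧
        (∀ β : ℝ, β₀ ≤ β → c₈ ≤ β * u 8 β) ∧
        (∀ (L L' : ℕ) (β : ℝ), β₀ ≤ β → 8 ≤ L → L ≤ L' → L' ≤ 2 * L →
            (∀ M : ℕ, 8 ≤ M → M ≤ L → u M β ≤ u₀) → |(u L β)⁻¹ - (u L' β)⁻¹| ≤ κ₂) ∧
        (∀ (k m : ℕ) (β : ℝ), β₀ ≤ β → (∀ M : ℕ, 8 ≤ M → M ≤ 8 * 2 ^ (k + m) → u M β ≤ u₀) →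
            κ₁ * m - κ₃ ≤ (u (8 * 2 ^ k) β)⁻¹ - (u (8 * 2 ^ (k + m)) β)⁻¹ ∧
              (u (8 * 2 ^ k) β)⁻¹ - (u (8 * 2 ^ (k + m)) β)⁻¹ ≤ κ₂ * m + κ₃) ∧
        (∀ (L : ℕ) [NeZero L] (β : ℝ), β₀ ≤ β → 8 ≤ L →
            (∀ M : ℕ, 8 ≤ M → M ≤ L → u M β ≤ u₀) →
            ∀ (P : (Fin 4 → ZMod L) → Fin 4 → Fin 4 → GaugeConfig 4 L G → ℝ)
              (E : (GaugeConfig 4 L G → ℝ) → ℝ),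
              (P = fun x i j U => (r.N : ℝ) - (r.ρ (plaquetteHolonomy U x i j)).trace.re) →
              (E = fun F => wilsonExpectation r.ρ β F) →
              c * u L β ^ 2 ≤
                ((L / 8 : ℕ) : ℝ) ^ 8 * (E (fun U => P 0 0 1 U * P (Pi.single (2 : Fin 4) ((L / 8 : ℕ) : ZMod L)) 0 1 U)
                  - E (P 0 0 1) * E (P (Pi.single (2 : Fin 4) ((L / 8 : ℕ) : ZMod L)) 0 1)) ∧
              ((L / 8 : ℕ) : ℝ) ^ 8 * (E (fun U => P 0 0 1 U * P (Pi.single (2 : Fin 4) ((L / 8 : ℕ) : ZMod L)) 0 1 U)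
                - E (P 0 0 1) * E (P (Pi.single (2 : Fin 4) ((L / 8 : ℕ) : ZMod L)) 0 1)) ≤ C * u L β ^ 2)) →
      (∃ (β₁ C' : ℝ),
        (∀ (L : ℕ) [NeZero L] (β : ℝ), β₁ ≤ β → 8 ≤ L → Even L → (L : ℝ) ^ 4 < Real.log β →
            (∀ M : ℕ, 8 ≤ M → M ≤ L → u M β ≤ u₀) →
            ∀ (P : (Fin 4 → ZMod L) → Fin 4 → Fin 4 → GaugeConfig 4 L G → ℝ)
              (E : (GaugeConfig 4 L G → ℝ) → ℝ),
              (P = fun x i j U => (r.N : ℝ) - (r.ρ (plaquetteHolonomy U x i j)).trace.re) →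
              (E = fun F => wilsonExpectation r.ρ β F) →
              E (fun U => P 0 0 1 U * P 0 0 1 U) - E (P 0 0 1) * E (P 0 0 1) ≤ C' * u 8 β ^ 2)) →
      (∃ (β₁ C' : ℝ),
        (∀ (L : ℕ) [NeZero L] (β : ℝ), β₁ ≤ β → 8 ≤ L → Odd L →
            (∀ M : ℕ, 8 ≤ M → M ≤ L → u M β ≤ u₀) →
            ∀ (P : (Fin 4 → ZMod L) → Fin 4 → Fin 4 → GaugeConfig 4 L G → ℝ)
              (E : (GaugeConfig 4 L G → ℝ) → ℝ),
              (P = fun x i j U => (r.N : ℝ) - (r.ρ (plaquetteHolonomy U x i j)).trace.re) →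
              (E = fun F => wilsonExpectation r.ρ β F) →
              E (fun U => P 0 0 1 U * P 0 0 1 U) - E (P 0 0 1) * E (P 0 0 1) ≤ C' * u 8 β ^ 2)) →
      ∃ (β₁ C' : ℝ),
          (∀ (L : ℕ) [NeZero L] (β : ℝ), β₁ ≤ β → 8 ≤ L → (∀ M : ℕ, 8 ≤ M → M ≤ L → u M β ≤ u₀) →
              ∀ (P : (Fin 4 → ZMod L) → Fin 4 → Fin 4 → GaugeConfig 4 L G → ℝ)
                (E : (GaugeConfig 4 L G → ℝ) → ℝ),
                (P = fun x i j U => (r.N : ℝ) - (r.ρ (plaquetteHolonomy U x i j)).trace.re) →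
                (E = fun F => wilsonExpectation r.ρ β F) →
                E (fun U => P 0 0 1 U * P 0 0 1 U) - E (P 0 0 1) * E (P 0 0 1) ≤ C' * u 8 β ^ 2) := by
  intro G _ _ _ _ _ _ hG r u u₀ β₀ κ₁ κ₂ κ₃ c C c₈ hR hVD hVO
  -- the two CLOSED variance pieces of line `birth`, applied to the R-bundle of this `u`
  obtain ⟨β₃, C₃, h₃⟩ := stub_varianceCeilingEvenBulk G hG r u u₀ β₀ κ₁ κ₂ κ₃ c C c₈ hR
  obtain ⟨β₄, C₄, h₄⟩ := stub_varianceCeilingEvenMid G hG r u u₀ β₀ κ₁ κ₂ κ₃ c C c₈ hR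
  -- the two OPEN pieces (hypotheses)
  obtain ⟨β₅, C₅, h₅⟩ := hVD
  obtain ⟨β₆, C₆, h₆⟩ := hVO
  refine ⟨max (max β₃ β₄) (max β₅ β₆), max (max C₃ C₄) (max C₅ C₆), ?_⟩
  intro L _ β hβ hL hwin P E hP hE
  have hβ₃ : β₃ ≤ β := ((le_max_left _ _).trans (le_max_left _ _)).trans hβ
  have hβ₄ : β₄ ≤ β := ((le_max_right _ _).trans (le_max_left _ _)).trans hβ
  have hβ₅ : β₅ ≤ β := ((le_max_left _ _).trans (le_max_right _ _)).trans hβ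
  have hβ₆ : β₆ ≤ β := ((le_max_right _ _).trans (le_max_right _ _)).trans hβ
  rcases Nat.even_or_odd L with hev | hodd
  · rcases le_or_gt (Real.log β) (L : ℝ) with hlog | hlog
    · -- even bulk `log β ≤ L`: landed `stub_varianceCeilingEvenBulk`
      exact le_max_mul_sq (le_max_mul_sq (h₃ L β hβ₃ hL hev hlog hwin P E hP hE))
    · rcases le_or_gt (Real.log β) ((L : ℝ) ^ 4) with h4 | h4
      · -- even middle regime `L < log β ≤ L⁴`: landed `stub_varianceCeilingEvenMid`
        exact le_max_mul_sq (le_max_mul_sq' (h₄ L β hβ₄ hL hev hlog h4 hwin P E hP hE))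
      · -- even deep-femto corner `L⁴ < log β`: hypothesis V_even-deep
        exact le_max_mul_sq' (le_max_mul_sq (h₅ L β hβ₅ hL hev h4 hwin P E hP hE))
  · -- odd boxes: hypothesis V_odd
    exact le_max_mul_sq' (le_max_mul_sq' (h₆ L β hβ₆ hL hodd hwin P E hP hE))

/-- **Up ⟸ TU ∧ LU ∧ V for a given coupling (line `conditional-covariance-floor`, sorry-free glue; registered sub-goal
`upperChannels_of_channels`).** For a compact group `G`, a lattice representation `r`, a box coupling `u` and a window
height `u₀`: if, each beyond its own threshold and with its own constant, on window boxes, the transverse upper profile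
TU `s⁸·Cov_{L,β}(P_0^{01}, P_{se₂}^{01}) ≤ C'·u(8s,β)²` (`8 ≤ L`, `1 ≤ s`, `8s ≤ L`; `hTU`, the shape of Up's first
conjunct), the longitudinal upper profile LU `s⁸·|Cov_{L,β}(P_0^{01}, P_{se₀}^{01})| ≤ C'·u(8s,β)²` (same range; `hLU`,
verbatim the consequent of birth's `stub_longitudinalUpper`) and the variance ceiling V `Var_{L,β}(P_0^{01}) ≤ C'·u(8,β)²`
(`8 ≤ L`; `hV`) hold, then Up's conclusion holds verbatim: ONE threshold `max β_TU (max β_LU β_V)` and ONE constant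
`max C_TU (max C_LU C_V)` serve the three clauses. Pure `max`-monotonicity; no clause of the R-bundle is needed, so none
is assumed. [folklore] -/
theorem upperChannels_of_channels :
    ∀ {G : Type} [Group G] [TopologicalSpace G] [IsTopologicalGroup G] [CompactSpace G]
        [MeasurableSpace G] [BorelSpace G] (r : LatticeRep G) (u : ℕ → ℝ → ℝ) (u₀ : ℝ),
      (∃ (β₁ C' : ℝ),
          (∀ (L : ℕ) [NeZero L] (β : ℝ) (s : ℕ), β₁ ≤ β → 8 ≤ L → 1 ≤ s → 8 * s ≤ L →
              (∀ M : ℕ, 8 ≤ M → M ≤ L → u M β ≤ u₀) →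
              ∀ (P : (Fin 4 → ZMod L) → Fin 4 → Fin 4 → GaugeConfig 4 L G → ℝ)
                (E : (GaugeConfig 4 L G → ℝ) → ℝ),
                (P = fun x i j U => (r.N : ℝ) - (r.ρ (plaquetteHolonomy U x i j)).trace.re) →
                (E = fun F => wilsonExpectation r.ρ β F) →
                (s : ℝ) ^ 8 * (E (fun U => P 0 0 1 U * P (Pi.single (2 : Fin 4) ((s : ℕ) : ZMod L)) 0 1 U)
                      - E (P 0 0 1) * E (P (Pi.single (2 : Fin 4) ((s : ℕ) : ZMod L)) 0 1)) ≤
                  C' * u (8 * s) β ^ 2)) →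
      (∃ (β₁ C' : ℝ),
        (∀ (L : ℕ) [NeZero L] (β : ℝ) (s : ℕ), β₁ ≤ β → 8 ≤ L → 1 ≤ s → 8 * s ≤ L →
            (∀ M : ℕ, 8 ≤ M → M ≤ L → u M β ≤ u₀) →
            ∀ (P : (Fin 4 → ZMod L) → Fin 4 → Fin 4 → GaugeConfig 4 L G → ℝ)
              (E : (GaugeConfig 4 L G → ℝ) → ℝ),
              (P = fun x i j U => (r.N : ℝ) - (r.ρ (plaquetteHolonomy U x i j)).trace.re) →
              (E = fun F => wilsonExpectation r.ρ β F) →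
              (s : ℝ) ^ 8 * |E (fun U => P 0 0 1 U * P (Pi.single (0 : Fin 4) ((s : ℕ) : ZMod L)) 0 1 U)
                  - E (P 0 0 1) * E (P (Pi.single (0 : Fin 4) ((s : ℕ) : ZMod L)) 0 1)| ≤
                C' * u (8 * s) β ^ 2)) →
      (∃ (β₁ C' : ℝ),
          (∀ (L : ℕ) [NeZero L] (β : ℝ), β₁ ≤ β → 8 ≤ L → (∀ M : ℕ, 8 ≤ M → M ≤ L → u M β ≤ u₀) →
              ∀ (P : (Fin 4 → ZMod L) → Fin 4 → Fin 4 → GaugeConfig 4 L G → ℝ)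
                (E : (GaugeConfig 4 L G → ℝ) → ℝ),
                (P = fun x i j U => (r.N : ℝ) - (r.ρ (plaquetteHolonomy U x i j)).trace.re) →
                (E = fun F => wilsonExpectation r.ρ β F) →
                E (fun U => P 0 0 1 U * P 0 0 1 U) - E (P 0 0 1) * E (P 0 0 1) ≤ C' * u 8 β ^ 2)) →
      ∃ (β₁ C' : ℝ),
          (∀ (L : ℕ) [NeZero L] (β : ℝ) (s : ℕ), β₁ ≤ β → 8 ≤ L → 1 ≤ s → 8 * s ≤ L →
              (∀ M : ℕ, 8 ≤ M → M ≤ L → u M β ≤ u₀) →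
              ∀ (P : (Fin 4 → ZMod L) → Fin 4 → Fin 4 → GaugeConfig 4 L G → ℝ)
                (E : (GaugeConfig 4 L G → ℝ) → ℝ),
                (P = fun x i j U => (r.N : ℝ) - (r.ρ (plaquetteHolonomy U x i j)).trace.re) →
                (E = fun F => wilsonExpectation r.ρ β F) →
                (s : ℝ) ^ 8 * (E (fun U => P 0 0 1 U * P (Pi.single (2 : Fin 4) ((s : ℕ) : ZMod L)) 0 1 U)
                      - E (P 0 0 1) * E (P (Pi.single (2 : Fin 4) ((s : ℕ) : ZMod L)) 0 1)) ≤
                  C' * u (8 * s) β ^ 2) ∧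
          (∀ (L : ℕ) [NeZero L] (β : ℝ) (s : ℕ), β₁ ≤ β → 8 ≤ L → 1 ≤ s → 8 * s ≤ L →
              (∀ M : ℕ, 8 ≤ M → M ≤ L → u M β ≤ u₀) →
              ∀ (P : (Fin 4 → ZMod L) → Fin 4 → Fin 4 → GaugeConfig 4 L G → ℝ)
                (E : (GaugeConfig 4 L G → ℝ) → ℝ),
                (P = fun x i j U => (r.N : ℝ) - (r.ρ (plaquetteHolonomy U x i j)).trace.re) →
                (E = fun F => wilsonExpectation r.ρ β F) →
                (s : ℝ) ^ 8 * |(E (fun U => P 0 0 1 U * P (Pi.single (0 : Fin 4) ((s : ℕ) : ZMod L)) 0 1 U)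
                      - E (P 0 0 1) * E (P (Pi.single (0 : Fin 4) ((s : ℕ) : ZMod L)) 0 1))| ≤
                  C' * u (8 * s) β ^ 2) ∧
          (∀ (L : ℕ) [NeZero L] (β : ℝ), β₁ ≤ β → 8 ≤ L → (∀ M : ℕ, 8 ≤ M → M ≤ L → u M β ≤ u₀) →
              ∀ (P : (Fin 4 → ZMod L) → Fin 4 → Fin 4 → GaugeConfig 4 L G → ℝ)
                (E : (GaugeConfig 4 L G → ℝ) → ℝ),
                (P = fun x i j U => (r.N : ℝ) - (r.ρ (plaquetteHolonomy U x i j)).trace.re) →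
                (E = fun F => wilsonExpectation r.ρ β F) →
                E (fun U => P 0 0 1 U * P 0 0 1 U) - E (P 0 0 1) * E (P 0 0 1) ≤ C' * u 8 β ^ 2) := by
  intro G _ _ _ _ _ _ r u u₀ hTU hLU hV
  obtain ⟨β₁, C₁, h₁⟩ := hTU
  obtain ⟨β₂, C₂, h₂⟩ := hLU
  obtain ⟨β₃, C₃, h₃⟩ := hV
  refine ⟨max β₁ (max β₂ β₃), max C₁ (max C₂ C₃), ?_, ?_, ?_⟩
  · -- TU: transverse upper profile
    intro L _ β s hβ hL hs hsL hwin P E hP hE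
    exact le_max_mul_sq (h₁ L β s ((le_max_left _ _).trans hβ) hL hs hsL hwin P E hP hE)
  · -- LU: longitudinal upper profile
    intro L _ β s hβ hL hs hsL hwin P E hP hE
    have hβ₂ : β₂ ≤ β := ((le_max_left _ _).trans (le_max_right _ _)).trans hβ
    exact le_max_mul_sq' (le_max_mul_sq (h₂ L β s hβ₂ hL hs hsL hwin P E hP hE))
  · -- V: variance ceiling
    intro L _ β hβ hL hwin P E hP hE
    have hβ₃ : β₃ ≤ β := ((le_max_right _ _).trans (le_max_right _ _)).trans hβ
    exact le_max_mul_sq' (le_max_mul_sq' (h₃ L β hβ₃ hL hwin P E hP hE))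

/-- **Up ⟸ R-bundle ∧ TU ∧ LU ∧ V_even-deep ∧ V_odd (line `conditional-covariance-floor`, the upper-channels bridge;
sorry-free composition of `upperChannels_of_channels` with `varianceCeiling_of_evenDeep_odd`).** For a compact simple Lie
group `G`, a lattice representation `r`, and a GIVEN box coupling `u` with constants `u₀ β₀ κ₁ κ₂ κ₃ c C c₈` carrying the
R-bundle `hR` (verbatim the antecedent of the registered `stub_upperChannels`): the four OPEN pieces of line `birth` for
this `u` — TU (`hTU`, second conjunct of the consequent of `stub_volumeDecoupling`), LU (`hLU`, consequent of
`stub_longitudinalUpper`), V_even-deep (`hVD`, consequent of `stub_varianceCeilingEvenDeep`) and V_odd (`hVO`, consequent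
of `stub_varianceCeilingOdd`) — imply the consequent of `stub_upperChannels` verbatim; the even variance boxes with
`log β ≤ L⁴` come from the landed `stub_varianceCeilingEvenBulk` / `stub_varianceCeilingEvenMid`. Use as
`upperChannels_of_parts G hG r u u₀ β₀ κ₁ κ₂ κ₃ c C c₈ hR hTU hLU hVD hVO`. [folklore] -/
theorem upperChannels_of_parts :
    ∀ (G : Type) [Group G] [TopologicalSpace G] [IsTopologicalGroup G] [CompactSpace G]
        [MeasurableSpace G] [BorelSpace G], IsCompactSimpleLieGroup G →
        ∀ r : LatticeRep G, ∀ (u : ℕ → ℝ → ℝ) (u₀ β₀ κ₁ κ₂ κ₃ c C c₈ : ℝ),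
      (0 < u₀ ∧ 0 < c ∧ 0 < κ₁ ∧ 0 ≤ κ₃ ∧ 0 < c₈ ∧
        (∀ (L : ℕ) (β : ℝ), 8 ≤ L → β₀ ≤ β → 0 < u L β) ∧
        (∀ L : ℕ, 8 ≤ L → ContinuousOn (u L) (Set.Ici β₀)) ∧
        (∀ L : ℕ, 8 ≤ L → Filter.Tendsto (u L) Filter.atTop (nhds 0)) ∧
        (∀ β : ℝ, β₀ ≤ β → c₈ ≤ β * u 8 β) ∧
        (∀ (L L' : ℕ) (β : ℝ), β₀ ≤ β → 8 ≤ L → L ≤ L' → L' ≤ 2 * L →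
            (∀ M : ℕ, 8 ≤ M → M ≤ L → u M β ≤ u₀) → |(u L β)⁻¹ - (u L' β)⁻¹| ≤ κ₂) ∧
        (∀ (k m : ℕ) (β : ℝ), β₀ ≤ β → (∀ M : ℕ, 8 ≤ M → M ≤ 8 * 2 ^ (k + m) → u M β ≤ u₀) →
            κ₁ * m - κ₃ ≤ (u (8 * 2 ^ k) β)⁻¹ - (u (8 * 2 ^ (k + m)) β)⁻¹ ∧
              (u (8 * 2 ^ k) β)⁻¹ - (u (8 * 2 ^ (k + m)) β)⁻¹ ≤ κ₂ * m + κ₃) ∧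
        (∀ (L : ℕ) [NeZero L] (β : ℝ), β₀ ≤ β → 8 ≤ L →
            (∀ M : ℕ, 8 ≤ M → M ≤ L → u M β ≤ u₀) →
            ∀ (P : (Fin 4 → ZMod L) → Fin 4 → Fin 4 → GaugeConfig 4 L G → ℝ)
              (E : (GaugeConfig 4 L G → ℝ) → ℝ),
              (P = fun x i j U => (r.N : ℝ) - (r.ρ (plaquetteHolonomy U x i j)).trace.re) →
              (E = fun F => wilsonExpectation r.ρ β F) →
              c * u L β ^ 2 ≤
                ((L / 8 : ℕ) : ℝ) ^ 8 * (E (fun U => P 0 0 1 U * P (Pi.single (2 : Fin 4) ((L / 8 : ℕ) : ZMod L)) 0 1 U)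
                  - E (P 0 0 1) * E (P (Pi.single (2 : Fin 4) ((L / 8 : ℕ) : ZMod L)) 0 1)) ∧
              ((L / 8 : ℕ) : ℝ) ^ 8 * (E (fun U => P 0 0 1 U * P (Pi.single (2 : Fin 4) ((L / 8 : ℕ) : ZMod L)) 0 1 U)
                - E (P 0 0 1) * E (P (Pi.single (2 : Fin 4) ((L / 8 : ℕ) : ZMod L)) 0 1)) ≤ C * u L β ^ 2)) →
      (∃ (β₁ C' : ℝ),
          (∀ (L : ℕ) [NeZero L] (β : ℝ) (s : ℕ), β₁ ≤ β → 8 ≤ L → 1 ≤ s → 8 * s ≤ L →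
              (∀ M : ℕ, 8 ≤ M → M ≤ L → u M β ≤ u₀) →
              ∀ (P : (Fin 4 → ZMod L) → Fin 4 → Fin 4 → GaugeConfig 4 L G → ℝ)
                (E : (GaugeConfig 4 L G → ℝ) → ℝ),
                (P = fun x i j U => (r.N : ℝ) - (r.ρ (plaquetteHolonomy U x i j)).trace.re) →
                (E = fun F => wilsonExpectation r.ρ β F) →
                (s : ℝ) ^ 8 * (E (fun U => P 0 0 1 U * P (Pi.single (2 : Fin 4) ((s : ℕ) : ZMod L)) 0 1 U)
                      - E (P 0 0 1) * E (P (Pi.single (2 : Fin 4) ((s : ℕ) : ZMod L)) 0 1)) ≤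
                  C' * u (8 * s) β ^ 2)) →
      (∃ (β₁ C' : ℝ),
        (∀ (L : ℕ) [NeZero L] (β : ℝ) (s : ℕ), β₁ ≤ β → 8 ≤ L → 1 ≤ s → 8 * s ≤ L →
            (∀ M : ℕ, 8 ≤ M → M ≤ L → u M β ≤ u₀) →
            ∀ (P : (Fin 4 → ZMod L) → Fin 4 → Fin 4 → GaugeConfig 4 L G → ℝ)
              (E : (GaugeConfig 4 L G → ℝ) → ℝ),
              (P = fun x i j U => (r.N : ℝ) - (r.ρ (plaquetteHolonomy U x i j)).trace.re) →
              (E = fun F => wilsonExpectation r.ρ β F) →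
              (s : ℝ) ^ 8 * |E (fun U => P 0 0 1 U * P (Pi.single (0 : Fin 4) ((s : ℕ) : ZMod L)) 0 1 U)
                  - E (P 0 0 1) * E (P (Pi.single (0 : Fin 4) ((s : ℕ) : ZMod L)) 0 1)| ≤
                C' * u (8 * s) β ^ 2)) →
      (∃ (β₁ C' : ℝ),
        (∀ (L : ℕ) [NeZero L] (β : ℝ), β₁ ≤ β → 8 ≤ L → Even L → (L : ℝ) ^ 4 < Real.log β →
            (∀ M : ℕ, 8 ≤ M → M ≤ L → u M β ≤ u₀) →
            ∀ (P : (Fin 4 → ZMod L) → Fin 4 → Fin 4 → GaugeConfig 4 L G → ℝ)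
              (E : (GaugeConfig 4 L G → ℝ) → ℝ),
              (P = fun x i j U => (r.N : ℝ) - (r.ρ (plaquetteHolonomy U x i j)).trace.re) →
              (E = fun F => wilsonExpectation r.ρ β F) →
              E (fun U => P 0 0 1 U * P 0 0 1 U) - E (P 0 0 1) * E (P 0 0 1) ≤ C' * u 8 β ^ 2)) →
      (∃ (β₁ C' : ℝ),
        (∀ (L : ℕ) [NeZero L] (β : ℝ), β₁ ≤ β → 8 ≤ L → Odd L →
            (∀ M : ℕ, 8 ≤ M → M ≤ L → u M β ≤ u₀) →
            ∀ (P : (Fin 4 → ZMod L) → Fin 4 → Fin 4 → GaugeConfig 4 L G → ℝ)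
              (E : (GaugeConfig 4 L G → ℝ) → ℝ),
              (P = fun x i j U => (r.N : ℝ) - (r.ρ (plaquetteHolonomy U x i j)).trace.re) →
              (E = fun F => wilsonExpectation r.ρ β F) →
              E (fun U => P 0 0 1 U * P 0 0 1 U) - E (P 0 0 1) * E (P 0 0 1) ≤ C' * u 8 β ^ 2)) →
      ∃ (β₁ C' : ℝ),
          (∀ (L : ℕ) [NeZero L] (β : ℝ) (s : ℕ), β₁ ≤ β → 8 ≤ L → 1 ≤ s → 8 * s ≤ L →
              (∀ M : ℕ, 8 ≤ M → M ≤ L → u M β ≤ u₀) →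
              ∀ (P : (Fin 4 → ZMod L) → Fin 4 → Fin 4 → GaugeConfig 4 L G → ℝ)
                (E : (GaugeConfig 4 L G → ℝ) → ℝ),
                (P = fun x i j U => (r.N : ℝ) - (r.ρ (plaquetteHolonomy U x i j)).trace.re) →
                (E = fun F => wilsonExpectation r.ρ β F) →
                (s : ℝ) ^ 8 * (E (fun U => P 0 0 1 U * P (Pi.single (2 : Fin 4) ((s : ℕ) : ZMod L)) 0 1 U)
                      - E (P 0 0 1) * E (P (Pi.single (2 : Fin 4) ((s : ℕ) : ZMod L)) 0 1)) ≤
                  C' * u (8 * s) β ^ 2) ∧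
          (∀ (L : ℕ) [NeZero L] (β : ℝ) (s : ℕ), β₁ ≤ β → 8 ≤ L → 1 ≤ s → 8 * s ≤ L →
              (∀ M : ℕ, 8 ≤ M → M ≤ L → u M β ≤ u₀) →
              ∀ (P : (Fin 4 → ZMod L) → Fin 4 → Fin 4 → GaugeConfig 4 L G → ℝ)
                (E : (GaugeConfig 4 L G → ℝ) → ℝ),
                (P = fun x i j U => (r.N : ℝ) - (r.ρ (plaquetteHolonomy U x i j)).trace.re) →
                (E = fun F => wilsonExpectation r.ρ β F) →
                (s : ℝ) ^ 8 * |(E (fun U => P 0 0 1 U * P (Pi.single (0 : Fin 4) ((s : ℕ) : ZMod L)) 0 1 U)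
                      - E (P 0 0 1) * E (P (Pi.single (0 : Fin 4) ((s : ℕ) : ZMod L)) 0 1))| ≤
                  C' * u (8 * s) β ^ 2) ∧
          (∀ (L : ℕ) [NeZero L] (β : ℝ), β₁ ≤ β → 8 ≤ L → (∀ M : ℕ, 8 ≤ M → M ≤ L → u M β ≤ u₀) →
              ∀ (P : (Fin 4 → ZMod L) → Fin 4 → Fin 4 → GaugeConfig 4 L G → ℝ)
                (E : (GaugeConfig 4 L G → ℝ) → ℝ),
                (P = fun x i j U => (r.N : ℝ) - (r.ρ (plaquetteHolonomy U x i j)).trace.re) →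
                (E = fun F => wilsonExpectation r.ρ β F) →
                E (fun U => P 0 0 1 U * P 0 0 1 U) - E (P 0 0 1) * E (P 0 0 1) ≤ C' * u 8 β ^ 2) :=
  fun G _ _ _ _ _ _ hG r u u₀ β₀ κ₁ κ₂ κ₃ c C c₈ hR hTU hLU hVD hVO =>
    upperChannels_of_channels r u u₀ hTU hLU
      (varianceCeiling_of_evenDeep_odd G hG r u u₀ β₀ κ₁ κ₂ κ₃ c C c₈ hR hVD hVO)

end Summit.QuantumFields.YangMills.Theorems.FemtoCurvatureTwoPointC

end
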